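import Mathlib
import Summits.NavierStokesRegularity.NavierStokesRegularity.Theorems.HeteroclinicTriggerChainTriggerChainFrontStepTruncWindowsForced
import Summits.NavierStokesRegularity.NavierStokesRegularity.Theorems.HeteroclinicTriggerChainTriggerChainFrontStepTruncDelaySharp
import HarnessLib

/-!
# `HeteroclinicTriggerChain` — crux `TriggerChainFrontStep` (item stmt-NavierStokesRegularity-22785):
  the DELAY PHASE with FORCING (front block of the lattice) — tools

The delay-phase core step (`…TruncDelaySharp`) re-proved for the FORCED front block
`x′ = −eu² − βuv + f₁`, `u′ = r·u`, `y′ = gu² − e′v² + f₃`, `v′ = β·x_v·u + e′·y_v·v`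
with additive forcings `|f₁| ≤ φ₁`, `|f₃| ≤ φ₃` (wake pump, table remainders, tail seed work), an abstract
trigger rate `|r − (ex − gy)| ≤ φ_r` and perturbed coefficient functions `|x_v − x| ≤ ψ_x`, `|y_v − y| ≤ ψ_y`
in the upper-trigger row (multiplicative remainders), on a window `[0, t]` with `u ≤ h` — the shape in which
the sibling seats' row formulas (`…ConnectionAlgebra`, `…SectorRows`, `…CarrierRow`) present the front rows of
an exact lattice flow. No energy conservation is assumed (the carrier may exceed `1` by `φ₁t`).
* `htcTP_pos_of_rate` — `u′ = r u`, `r` continuous, `u(0) > 0` ⇒ `u > 0` (integrating factor);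
* `htcTP_upper_bound_sharp_on` — the sharp centre-drift bound with the carrier ceiling assumed on the window
  only;
The core step of the forced delay phase is in `…TruncDelayForced`.

HONEST FRAMING: elementary real-analysis facts about a forced four-dimensional quadratic ODE (MODEL front
block of Tao's lattice, Tao 2016 §4); helper lemmas for the crux, no stub credit; nothing here is a statement
about the Navier–Stokes equations; no summit, rung or crux is proved. NS regularity is not proved by this line.
-/

noncomputable section

-- the sub-problem namespace `Summit.NavierStokesRegularity.NavierStokesRegularity` repeats the summit name by design (D-0017)
set_option linter.dupNamespace false

open Real Set

namespace Summit.NavierStokesRegularity.NavierStokesRegularity.Theorems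

/-- **The trigger keeps its sign for an abstract continuous rate**: `u′ = r u`, `u(0) > 0` ⇒ `u > 0`
(`u = u(0)·exp(∫₀ r)`). [folklore] -/
theorem htcTP_pos_of_rate {u r : ℝ → ℝ} (hu : ∀ s, HasDerivAt u (r s * u s) s) (hrc : Continuous r)
    (hu0 : 0 < u 0) : ∀ s, 0 < u s := by
  have hR := htcST_hasDerivAt_primitive hrc
  have hQ : ∀ s, HasDerivAt (fun q => u q * Real.exp (-(∫ τ in (0 : ℝ)..q, r τ))) 0 s := by
    intro s
    have h1 := (hu s).mul (hR s).neg.exp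
    refine h1.congr_deriv ?_
    simp only [Pi.neg_apply]
    ring
  intro s
  have hconst := is_const_of_deriv_eq_zero (fun q => (hQ q).differentiableAt) (fun q => (hQ q).deriv) s 0
  simp only [intervalIntegral.integral_same, neg_zero, Real.exp_zero, mul_one] at hconst
  have hpos : 0 < Real.exp (-(∫ τ in (0 : ℝ)..s, r τ)) := Real.exp_pos _
  have h2 : 0 < u s * Real.exp (-(∫ τ in (0 : ℝ)..s, r τ)) := by rw [hconst]; exact hu0
  exact pos_of_mul_pos_left h2 hpos.le

/-- **Centre drift of the upper trigger, sharp form, hypotheses on the window only.** If `v′ = βxu + e′yv`, `u′ = ru` with `r ≥ e/2`,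
`x ≤ 1`, `u, v ≥ 0` and `y ≤ (g/e)u² + 2Y₀` on `[0, t]` (`g, Y₀ ≥ 0`), then with
`Ψ(s) = 2e′Y₀s + (e′g/e²)u(s)²`: `v(s) ≤ e^{Ψ(s)} (v(0) + 2βu(s)/e)` on `[0, t]`
(`G = e·v·e^{−Ψ} − 2βu` is non-increasing, because `Ψ′ = 2e′Y₀ + (2e′g/e²)ru² ≥ e′y`). [folklore] -/
theorem htcTP_upper_bound_sharp_on {x u y v r : ℝ → ℝ} {β e e' g Y₀ : ℝ} (he : 0 < e) (hβ : 0 ≤ β)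
    (he' : 0 ≤ e') (hg : 0 ≤ g) (hY₀ : 0 ≤ Y₀)
    (hv : ∀ s, HasDerivAt v (β * x s * u s + e' * y s * v s) s)
    (hu' : ∀ s, HasDerivAt u (r s * u s) s) (hunn : ∀ s, 0 ≤ u s)
    {t : ℝ} (hx1 : ∀ s ∈ Icc 0 t, x s ≤ 1) (hr : ∀ s ∈ Icc 0 t, e / 2 ≤ r s) (hvnn : ∀ s ∈ Icc 0 t, 0 ≤ v s)
    (hy2 : ∀ s ∈ Icc 0 t, y s ≤ g / e * u s ^ 2 + 2 * Y₀) :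
    ∀ s ∈ Icc 0 t,
      v s ≤ Real.exp (2 * e' * Y₀ * s + e' * g / e ^ 2 * u s ^ 2) * (v 0 + 2 * β * u s / e) := by
  -- the integrating factor Ψ and E = exp(−Ψ)
  have hu2 : ∀ s, HasDerivAt (fun q => u q ^ 2) (2 * u s * (r s * u s)) s := by
    intro s
    have h1 := (hu' s).mul (hu' s)
    have h2 : (fun q => u q ^ 2) = fun q => u q * u q := funext fun q => sq (u q)
    rw [h2]
    exact h1.congr_deriv (by ring)
  have hΨ : ∀ s, HasDerivAt (fun q => -(2 * e' * Y₀ * q + e' * g / e ^ 2 * u q ^ 2))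
      (-(2 * e' * Y₀ * 1 + e' * g / e ^ 2 * (2 * u s * (r s * u s)))) s := fun s =>
    (((hasDerivAt_id' s).const_mul (2 * e' * Y₀)).add ((hu2 s).const_mul (e' * g / e ^ 2))).neg
  have hG : ∀ s, HasDerivAt
      (fun q => e * (v q * Real.exp (-(2 * e' * Y₀ * q + e' * g / e ^ 2 * u q ^ 2))) - 2 * β * u q)
      (e * ((β * x s * u s + e' * y s * v s) * Real.exp (-(2 * e' * Y₀ * s + e' * g / e ^ 2 * u s ^ 2)) +
        v s * (Real.exp (-(2 * e' * Y₀ * s + e' * g / e ^ 2 * u s ^ 2)) *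
          (-(2 * e' * Y₀ * 1 + e' * g / e ^ 2 * (2 * u s * (r s * u s)))))) -
        2 * β * (r s * u s)) s :=
    fun s => (((hv s).mul (hΨ s).exp).const_mul e).sub ((hu' s).const_mul _)
  have hG' : ∀ s ∈ Icc 0 t,
      e * ((β * x s * u s + e' * y s * v s) * Real.exp (-(2 * e' * Y₀ * s + e' * g / e ^ 2 * u s ^ 2)) +
        v s * (Real.exp (-(2 * e' * Y₀ * s + e' * g / e ^ 2 * u s ^ 2)) *
          (-(2 * e' * Y₀ * 1 + e' * g / e ^ 2 * (2 * u s * (r s * u s)))))) -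
        2 * β * (r s * u s) ≤ 0 := by
    intro s hs
    set E : ℝ := Real.exp (-(2 * e' * Y₀ * s + e' * g / e ^ 2 * u s ^ 2)) with hE
    have hE0 : 0 ≤ E := (Real.exp_pos _).le
    have hE1 : E ≤ 1 := by
      rw [hE, Real.exp_le_one_iff, neg_nonpos]
      have := hs.1
      positivity
    have hus := hunn s
    have hvs := hvnn s hs
    have hrs := hr s hs
    -- seed term
    have t1 : β * x s * u s * E ≤ β * u s := by
      have h1 : β * x s * u s ≤ β * u s := by
        have h2 := mul_le_mul_of_nonneg_left (hx1 s hs) (mul_nonneg hβ hus)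
        calc β * x s * u s = β * u s * x s := by ring
          _ ≤ β * u s * 1 := h2
          _ = β * u s := by ring
      calc β * x s * u s * E ≤ β * u s * E := mul_le_mul_of_nonneg_right h1 hE0
        _ ≤ β * u s * 1 := mul_le_mul_of_nonneg_left hE1 (mul_nonneg hβ hus)
        _ = β * u s := by ring
    -- amplification term: e′y ≤ Ψ′
    have t2 : (e' * y s * v s +
        v s * (-(2 * e' * Y₀ * 1 + e' * g / e ^ 2 * (2 * u s * (r s * u s))))) * E ≤ 0 := by
      have h1 : e' * y s ≤ 2 * e' * Y₀ * 1 + e' * g / e ^ 2 * (2 * u s * (r s * u s)) := by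
        have h2 : e' * y s ≤ e' * (g / e * u s ^ 2 + 2 * Y₀) := mul_le_mul_of_nonneg_left (hy2 s hs) he'
        have h3 : e' * (g / e * u s ^ 2) ≤ e' * g / e ^ 2 * (2 * u s * (r s * u s)) := by
          have h4 : e' * g / e ^ 2 * (2 * u s * (r s * u s)) - e' * (g / e * u s ^ 2) =
              2 * (e' * g / e ^ 2) * u s ^ 2 * (r s - e / 2) := by
            field_simp
          have h5 : 0 ≤ 2 * (e' * g / e ^ 2) * u s ^ 2 * (r s - e / 2) := by
            have : 0 ≤ r s - e / 2 := by linarith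
            positivity
          linarith
        linarith
      have h6 : (e' * y s * v s +
          v s * (-(2 * e' * Y₀ * 1 + e' * g / e ^ 2 * (2 * u s * (r s * u s))))) =
          -(v s * ((2 * e' * Y₀ * 1 + e' * g / e ^ 2 * (2 * u s * (r s * u s))) - e' * y s)) := by ring
      rw [h6]
      have h7 : 0 ≤ v s * ((2 * e' * Y₀ * 1 + e' * g / e ^ 2 * (2 * u s * (r s * u s))) - e' * y s) :=
        mul_nonneg hvs (by linarith)
      exact mul_nonpos_iff.2 (Or.inr ⟨by linarith, hE0⟩)
    -- growth term
    have t3 : e * (β * u s) ≤ 2 * β * (r s * u s) := by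
      have h1 : 2 * β * (r s * u s) - e * (β * u s) = 2 * (β * u s) * (r s - e / 2) := by ring
      have h2 : 0 ≤ 2 * (β * u s) * (r s - e / 2) :=
        mul_nonneg (mul_nonneg (by norm_num) (mul_nonneg hβ hus)) (by linarith)
      linarith
    have h4 : e * ((β * x s * u s + e' * y s * v s) * E +
        v s * (E * (-(2 * e' * Y₀ * 1 + e' * g / e ^ 2 * (2 * u s * (r s * u s)))))) =
        e * (β * x s * u s * E) + e * ((e' * y s * v s +
          v s * (-(2 * e' * Y₀ * 1 + e' * g / e ^ 2 * (2 * u s * (r s * u s))))) * E) := by ring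
    rw [h4]
    have h5 : e * (β * x s * u s * E) ≤ e * (β * u s) := mul_le_mul_of_nonneg_left t1 he.le
    have h6 : e * ((e' * y s * v s +
        v s * (-(2 * e' * Y₀ * 1 + e' * g / e ^ 2 * (2 * u s * (r s * u s))))) * E) ≤ 0 :=
      mul_nonpos_iff.2 (Or.inl ⟨he.le, t2⟩)
    linarith
  have hGle := htcTP_le_of_deriv_nonpos hG hG'
  intro s hs
  have h1 := hGle s hs
  simp only [mul_zero, zero_add] at h1
  -- at time 0: E(0) ≤ 1, so the right-hand side is ≤ e v0
  have hE00 : Real.exp (-(e' * g / e ^ 2 * u 0 ^ 2)) ≤ 1 := by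
    rw [Real.exp_le_one_iff, neg_nonpos]; positivity
  have h2 : e * (v s * Real.exp (-(2 * e' * Y₀ * s + e' * g / e ^ 2 * u s ^ 2))) ≤
      e * (v 0 + 2 * β * u s / e) := by
    have h3 : e * (v 0 + 2 * β * u s / e) = e * v 0 + 2 * β * u s := by
      field_simp
    have h4 : 0 ≤ 2 * β * u 0 := by have := hunn 0; positivity
    have h5 : e * (v 0 * Real.exp (-(e' * g / e ^ 2 * u 0 ^ 2))) ≤ e * v 0 := by
      have h6 : v 0 * Real.exp (-(e' * g / e ^ 2 * u 0 ^ 2)) ≤ v 0 * 1 :=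
        mul_le_mul_of_nonneg_left hE00 (hvnn 0 (left_mem_Icc.2 (hs.1.trans hs.2)))
      have h7 := mul_le_mul_of_nonneg_left h6 he.le
      linarith
    linarith
  have h5 : v s * Real.exp (-(2 * e' * Y₀ * s + e' * g / e ^ 2 * u s ^ 2)) ≤ v 0 + 2 * β * u s / e :=
    le_of_mul_le_mul_left h2 he
  have h6 : v s = v s * Real.exp (-(2 * e' * Y₀ * s + e' * g / e ^ 2 * u s ^ 2)) *
      Real.exp (2 * e' * Y₀ * s + e' * g / e ^ 2 * u s ^ 2) := by
    rw [mul_assoc, ← Real.exp_add, neg_add_cancel, Real.exp_zero, mul_one]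
  rw [h6, mul_comm (Real.exp (2 * e' * Y₀ * s + e' * g / e ^ 2 * u s ^ 2))]
  exact mul_le_mul_of_nonneg_right h5 (Real.exp_pos _).le

end Summit.NavierStokesRegularity.NavierStokesRegularity.Theorems

end
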